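import Literature.NumberTheory.EllipticCurves.BigRepModuleShapiroDualityProofs
import Literature.NumberTheory.EllipticCurves.BigRepModuleShapiroLocalConditionsProofs
import Literature.NumberTheory.EllipticCurves.GreenbergVatsal2000.GreenbergSelmerGroups
import Literature.NumberTheory.EllipticCurves.CyclotomicZpExtensionUnramifiedAwayPProofs
import Literature.NumberTheory.IwasawaTheory.Greenberg2006.TwistDeformation
import Literature.NumberTheory.GaloisRepresentations.IntegralGaloisActionProofs
import Literature.NumberTheory.GaloisRepresentations.AbsGaloisOuterConj
import HarnessLib

/-!
# T-42-mult in the kernel, XLVIII — P49-KERNEL (6a): the IMAGE of Shapiro's bijection —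
# `[c]|_{N_S} = 0 ⟺ Sh[c] ∈ H¹(K_Σ/K_∞, E[p^∞])` (Greenberg–Vatsal's `unramifiedOutside`)

Cell `bsd-2adic` (run/shared/lean/pub/bsd-2adic/), seat `bsd-2adic-t42` GEN 18 (pen RC-315 (b); memo
`t42/DESIGN-T42-ADDENDUM-21` §A21.3 (I4)). HONEST FRAMING: research route; THEOREMS ONLY (no `def`, no named fact,
no instance, no `sorry`); nothing booked; BSD is not proved by any of this. PARTITION: X5@2 multiplicative GV-transport
rows (K4ᵐ B1·O1; PRINT binder P49 of `multCongruenceTransportAtTwo_of_print49`) × all p — reduces-the-named-input-of;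
bears_on K4 19922 / 19923 (`--supports stmt-BirchSwinnertonDyer-19923`).

PRINT (Greenberg, LNM 1716 (1999), proof of Prop. 4.9, p. 113): "`H¹(K_Σ/K_∞, E[p^∞]) = H¹(K_Σ/K, 𝒜)`, where
`𝒜 = E[p^∞] ⊗ Λ^*(κ⁻¹)` … (Shapiro's lemma)". Shapiro's bijection `[c] ↦ [h ↦ c(h)(0)]` is `H¹(Γ_K, 𝒜_Γ) ≃ H¹(K_∞, E[p^∞])`
(file XLVII); to descend to `K_Σ` on both sides one must know WHICH classes of `Γ_K` come from `G_{K,S} = Gal(K_S/K)`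
(those vanishing on the ramification subgroup `N_S`) and where they go (the classes unramified outside `Σ = S₀ ∪ {p, ∞}`
in Greenberg–Vatsal's place-by-place sense, `GreenbergVatsal2000.unramifiedOutside`). This file proves that dictionary,
for every number field `K`, every prime `p`, every `ℤ_p`-extension `κ`, `S = S₀ ∪ {v ∣ p}` with `N_S` fixing `E[p^∞]`:

* §1 `N_S` acts trivially on `𝒜_Γ` (`K_∞ ⊆ K_S`: `ramificationSubgroup_le_kerSubgroup`, Washington 13.2 via the tree's
  `ZpExtension.inertia_le_kerSubgroup_holds`); the chosen inertia group `I_v = I_{𝔓₀} ≤ N_S` for `v ∉ S`.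
* §2 cocycle bookkeeping (conjugation / restriction on explicit classes; the Shapiro cocycle in the subspace-topology
  instance of `W.subgroupH1`).
* §3 (⇒) `shapiro_mem_unramifiedOutside_of_apply_eq_zero`: if `c|_{N_S} = 0` then every conjugate `conj_σ [h ↦ c(h)(0)]`
  dies on `ker κ ⊓ I_v` (`σ⁻¹ I_v σ ⊆ N_S`). (⇐) `apply_eq_zero_of_shapiro_mem_unramifiedOutside`: unramifiedness of every
  conjugate gives `c(σ⁻¹ x σ)(0) = 0` for `x ∈ I_{𝔓₀}` (which acts trivially, `I_{𝔓₀} ≤ N_S`); the conjugation identity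
  `ρ(σ)·c(σ⁻¹ x σ)(0) = c(x)(κ σ) + (x·b − b)` (`BigRepModule.rho_apply_conj_zero` — Shapiro turns conjugates into the
  values at `κ σ ∈ Γ`) and `κ(Γ_K) = ℤ_p` give `c(x) = 0`; finally `{n ∈ N_S | c(n) = 0}` is a closed normal subgroup
  (`c(g n g⁻¹) = c(g) + g·c(g⁻¹) = 0`) containing every `I_𝔓 = τ I_{𝔓₀} τ⁻¹`, `𝔓 ∣ v ∉ S` (transitivity on primes,
  `exists_smul_eq_of_mem_primesAbove_holds`), hence all of `N_S`.

The sequel (6b, `…P49KernelInflation`) adds inflation–restriction and assembles the bridge `Sh` of input (I4).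

References: [GreenbergLNM1716] proof of Prop. 4.9 p. 113; [GreenbergVatsal2000] §2 pp. 16–17, 23;
[NeukirchSchmidtWingberg2008] VIII §3; [SkinnerUrban2014] §3.1.1–3.1.2, Prop. 3.2.3; [NeukirchANT1999] I §9, II §9;
[Washington1997] Prop. 13.2; [Greenberg2006] p. 341 L39 – p. 342 L4.
-/

set_option autoImplicit false
set_option linter.dupNamespace false

noncomputable section

open scoped Classical

namespace Summit.BirchSwinnertonDyer.BirchSwinnertonDyer.Theorems.P49Kernel

open Multiplicative Field IsDedekindDomain NumberField WeierstrassCurve CategoryTheory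
open Literature.NumberTheory.EllipticCurves Literature.NumberTheory.EllipticCurves.BigGaloisRep
  Literature.NumberTheory.EllipticCurves.GreenbergSelmer Literature.NumberTheory.EllipticCurves.GreenbergVatsal2000
  Literature.NumberTheory.GaloisRepresentations

/-! ## §1. The ramification subgroup `N_S` does not move `𝒜_Γ = E[p^∞] ⊗ Λ^*(κ⁻¹)` -/

section Basic

variable {K : Type} [Field K] [NumberField K] (W : WeierstrassCurve K) {p : ℕ} [Fact p.Prime]
  (κ : ZpExtension K p) {S : Set (HeightOneSpectrum (𝓞 K))}

/-- `N_S ≤ ker κ` when `S ⊇ {v ∣ p}`: a `ℤ_p`-extension is unramified outside `p` (the tree's theorem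
`ZpExtension.inertia_le_kerSubgroup_holds`, packaged as `ramificationSubgroup_le_multiZpKer`).
[cite: Washington1997, Prop. 13.2] [cite: Greenberg2006, p. 341 L39–45] -/
theorem ramificationSubgroup_le_kerSubgroup
    (hSp : ∀ v : HeightOneSpectrum (𝓞 K), ((p : ℕ) : 𝓞 K) ∈ v.asIdeal → v ∈ S) :
    ramificationSubgroup K S ≤ κ.kerSubgroup := fun n hn ↦ by
  have h := Literature.NumberTheory.IwasawaTheory.Greenberg2006.ramificationSubgroup_le_multiZpKer
    (S := S) p (fun _ : Fin 1 ↦ κ) hSp hn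
  rw [Literature.NumberTheory.IwasawaTheory.Greenberg2006.mem_multiZpKer_iff] at h
  exact ZpExtension.mem_kerSubgroup.2 (h 0)

/-- **`N_S` acts trivially on `𝒜_Γ = E[p^∞] ⊗ Λ^*(κ⁻¹)`** when `S ⊇ {v ∣ p}` and `N_S` fixes `E[p^∞]` pointwise
(`S ⊇` the bad places, Néron–Ogg–Shafarevich): `(n · Φ)(x) = n • Φ(x − κ n) = Φ(x)`.
[cite: GreenbergLNM1716, proof of Prop. 4.9 p. 113 (`𝒜` is a `Gal(K_Σ/K)`-module)] [cite: SilvermanAEC2009, Thm. VII.7.1] -/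
theorem anticyclotomicBigGaloisRep_apply_of_mem_ramificationSubgroup [TopologicalSpace (PowerSeries ℤ_[p])]
    (hSp : ∀ v : HeightOneSpectrum (𝓞 K), ((p : ℕ) : 𝓞 K) ∈ v.asIdeal → v ∈ S)
    (hNS : ∀ n ∈ ramificationSubgroup K S, ∀ P : PrimaryTorsion W.geomPoints p, n • P = P)
    {n : absoluteGaloisGroup K} (hn : n ∈ ramificationSubgroup K S)
    (Φ : BigRepModule ℤ_[p] p (PrimaryTorsion W.geomPoints p)) :
    AnticyclotomicBigGaloisRep κ (W.primaryTorsionGaloisRep p) n Φ = Φ := by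
  have hκn : κ n = 1 := ZpExtension.mem_kerSubgroup.1 (ramificationSubgroup_le_kerSubgroup κ hSp hn)
  refine BigRepModule.ext fun x ↦ ?_
  change bigRep κ.toContinuousMonoidHom (W.primaryTorsionGaloisRep p) n Φ x = Φ x
  rw [bigRep_apply_apply, ZpExtension.coe_toContinuousMonoidHom, hκn, toAdd_one, sub_zero]
  exact hNS n hn (Φ x)

/-- The chosen inertia group `I_v = GreenbergSelmer.inertia v` (image of `I_{K_v}`) lies in `N_S` for `v ∉ S`
(`I_v = I_{𝔓₀}`, `𝔓₀ = adicCompletionPrime K v`, `inertia_adicCompletionPrime_eq_map_absInertia`).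
[cite: NeukirchANT1999, Ch. II §9 Prop. (9.6)] [cite: NeukirchSchmidtWingberg2008, VIII §3] -/
theorem greenbergInertia_le_ramificationSubgroup {v : HeightOneSpectrum (𝓞 K)} (hv : v ∉ S) :
    GreenbergSelmer.inertia v ≤ ramificationSubgroup K S := by
  have e : GreenbergSelmer.inertia v = (adicCompletionPrime K v).inertia (absoluteGaloisGroup K) :=
    (inertia_adicCompletionPrime_eq_map_absInertia K v).symm
  rw [e]
  exact inertia_le_ramificationSubgroup hv (adicCompletionPrime_mem_primesAbove K v)

end Basic

/-! ## §2. Cocycle bookkeeping: the Shapiro cocycle (subspace instance), conjugation and restriction on classes -/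

section Cocycles

variable {K : Type} [Field K] {A : Type} [AddCommGroup A] [DistribMulAction (absoluteGaloisGroup K) A]
  [TopologicalSpace A] [DiscreteTopology A]

/-- Conjugation on classes of explicit cocycles: `conj_σ [z] = [x ↦ σ • z(σ⁻¹ x σ)]` (`map_oneCocycleClass` along the
compatible pair `(subgroupConj H σ, σ • ·)`). Serre, *Galois Cohomology*, I §5.1 with I §2.5. -/
private theorem conjH1_oneCocycleClass_eq' (H : Subgroup (absoluteGaloisGroup K)) [H.Normal]
    (σ : absoluteGaloisGroup K) (z : contOneCocycles (discreteTopRep H A)) :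
    conjH1 H A σ (oneCocycleClass _ z) =
      oneCocycleClass (discreteTopRep H A)
        (contOneCocycles.pullback (subgroupConj H σ)
          (resHomOfEquivariant (subgroupConj H σ) (DistribSMul.toAddMonoidHom A σ) fun x m ↦ by
            simp only [DistribSMul.toAddMonoidHom_apply, Subgroup.smul_def, subgroupConj_apply_coe,
              smul_smul, mul_assoc, mul_inv_cancel_left]) z) :=
  map_oneCocycleClass (X := discreteTopRep H A) (Y := discreteTopRep H A) (subgroupConj H σ) _ z

end Cocycles

section ResClass

variable {G : Type} [Group G] [TopologicalSpace G] [IsTopologicalGroup G]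
  {M : Type} [AddCommGroup M] [DistribMulAction G M] [TopologicalSpace M] [DiscreteTopology M]
  {D : Type} [Group D] [TopologicalSpace D] [IsTopologicalGroup D]
  {M' : Type} [AddCommGroup M'] [DistribMulAction D M'] [TopologicalSpace M'] [DiscreteTopology M']

/-- `res_{(φ, ψ)} [f] = [ψ ∘ f ∘ φ]` on explicit cocycles (`map_oneCocycleClass`; the tree's
`resH1Hom_oneCocycleClass`, re-derived to keep the import light). Serre, *Galois Cohomology*, I §2.4. -/
private theorem resH1Hom_oneCocycleClass_eq' (φ : D →ₜ* G) (ψ : M →+ M')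
    (h : ∀ (x : D) (m : M), ψ (φ x • m) = x • ψ m) (f : contOneCocycles (discreteTopRep G M)) :
    resH1Hom φ ψ h (oneCocycleClass (discreteTopRep G M) f) =
      oneCocycleClass (discreteTopRep D M') (contOneCocycles.pullback φ (resHomOfEquivariant φ ψ h) f) :=
  map_oneCocycleClass (X := discreteTopRep G M) (Y := discreteTopRep D M') φ (resHomOfEquivariant φ ψ h) f

end ResClass

/-! ## §3. The image of Shapiro: `[c]|_{N_S} = 0 ⟺ Sh[c]` is unramified outside `S₀ ∪ {v ∣ p}` -/

section Unramified

variable {K : Type} [Field K] [NumberField K] (W : WeierstrassCurve K) {p : ℕ} [Fact p.Prime]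
  (κ : ZpExtension K p) {S S₀ : Set (HeightOneSpectrum (𝓞 K))}
  [TopologicalSpace (PowerSeries ℤ_[p])]
  [ContinuousSMul (PowerSeries ℤ_[p]) (BigRepModule ℤ_[p] p (PrimaryTorsion W.geomPoints p))]

/-- **The Shapiro cocycle `h ↦ c(h)(0)` on `ker κ`**, as a continuous cocycle of the curve's `E[p^∞] = W.geomPrimaryTorsion p`
with its SUBSPACE-topology instance (the instance of `W.subgroupH1`; transported from the tree's
`SkinnerUrban2014.exists_shapiro_cocycle` along `exists_subgroupH1_addEquiv_of_discrete`).
[cite: SkinnerUrban2014, §3.1.1 and Prop. 3.2.3 (proof: Shapiro's lemma)] -/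
theorem exists_shapiro_cocycle_geomPrimaryTorsion
    (c : contOneCocycles (AnticyclotomicBigGaloisRep κ (W.primaryTorsionGaloisRep p)).toTopRep) :
    ∃ z : contOneCocycles (discreteTopRep κ.kerSubgroup ↥(W.geomPrimaryTorsion p)),
      ∀ h : κ.kerSubgroup, (z.1 h : PrimaryTorsion (geomPoints W) p) =
        (c.1 (h : absoluteGaloisGroup K) : BigRepModule ℤ_[p] p (PrimaryTorsion (geomPoints W) p)) 0 := by
  have hρ : ∀ (g : absoluteGaloisGroup K) (a : PrimaryTorsion (geomPoints W) p),
      W.primaryTorsionGaloisRep p g a = g • a := fun g a ↦ rfl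
  obtain ⟨z₁, hz₁⟩ := SkinnerUrban2014.exists_shapiro_cocycle κ (W.primaryTorsionGaloisRep p) hρ c
  obtain ⟨𝔭, h𝔭0, h𝔭⟩ := Ring.not_isField_iff_exists_prime.1 (RingOfIntegers.not_isField K)
  obtain ⟨-, -, hz, -, -⟩ := exists_subgroupH1_addEquiv_of_discrete κ.kerSubgroup
    (PrimaryTorsion (geomPoints W) p) PrimaryTorsion.instTopologicalSpace instTopologicalSpaceSubtype
    inferInstance (inferInstance : DiscreteTopology ↥(W.geomPrimaryTorsion p)) p ⟨𝔭, h𝔭, h𝔭0⟩ ∅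
  obtain ⟨z₂, hz₂⟩ := hz z₁
  exact ⟨z₂, fun h ↦ (hz₂ h).symm.trans (hz₁ h)⟩

/-- **(⇒) A cocycle of `Γ_K` in `𝒜_Γ` vanishing on `N_S` has Shapiro class in `H¹(K_Σ/K_∞, E[p^∞])`**, `Σ = S₀ ∪ {v ∣ p} ⊇ S`:
at `v ∉ S₀`, `v ∤ p` and any conjugate `σ`, the restriction of `conj_σ [h ↦ c(h)(0)]` to `ker κ ⊓ I_v` is the class of
`x ↦ σ • c(σ⁻¹ x σ)(0) = 0`, because `σ⁻¹ I_v σ ⊆ N_S` (`I_v = I_{𝔓₀} ≤ N_S`, `N_S` normal).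
[cite: GreenbergLNM1716, proof of Prop. 4.9 p. 113] [cite: GreenbergVatsal2000, §2 pp. 16, 23] [cite: NeukirchSchmidtWingberg2008, VIII §3] -/
theorem shapiro_mem_unramifiedOutside_of_apply_eq_zero
    (hSle : ∀ v : HeightOneSpectrum (𝓞 K), v ∉ S₀ → ((p : ℕ) : 𝓞 K) ∉ v.asIdeal → v ∉ S)
    (c : contOneCocycles (AnticyclotomicBigGaloisRep κ (W.primaryTorsionGaloisRep p)).toTopRep)
    (hc : ∀ n ∈ ramificationSubgroup K S,
      (c.1 n : BigRepModule ℤ_[p] p (PrimaryTorsion (geomPoints W) p)) = 0)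
    (z : contOneCocycles (discreteTopRep κ.kerSubgroup ↥(W.geomPrimaryTorsion p)))
    (hz : ∀ h : κ.kerSubgroup, (z.1 h : PrimaryTorsion (geomPoints W) p) =
      (c.1 (h : absoluteGaloisGroup K) : BigRepModule ℤ_[p] p (PrimaryTorsion (geomPoints W) p)) 0) :
    (oneCocycleClass _ z : W.subgroupH1 p κ.kerSubgroup) ∈
      unramifiedOutside κ.kerSubgroup ↥(W.geomPrimaryTorsion p) p S₀ := by
  rw [mem_unramifiedOutside_iff]
  intro v hv₀ hpv σ
  have hvS : v ∉ S := hSle v hv₀ hpv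
  rw [GreenbergVatsal2000.unramifiedKer, AddMonoidHom.mem_ker, conjH1_oneCocycleClass_eq', resH1Hom_oneCocycleClass_eq',
    oneCocycleClass_eq_zero_iff]
  refine ⟨0, fun x ↦ ?_⟩
  rw [map_zero, sub_zero]
  -- the value of the doubly pulled-back cocycle at `x ∈ ker κ ⊓ I_v` is `σ • c(σ⁻¹ x σ)(0)`
  change σ • z.1 (subgroupConj κ.kerSubgroup σ (inertiaInToH κ.kerSubgroup v x)) = 0
  have hxI : ((x : GreenbergSelmer.decomp (K := K) v) : absoluteGaloisGroup K) ∈ GreenbergSelmer.inertia v :=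
    ((mem_inertiaIn_iff κ.kerSubgroup v x).1 x.2).2
  have hxN : σ⁻¹ * ((x : GreenbergSelmer.decomp (K := K) v) : absoluteGaloisGroup K) * σ ∈
      ramificationSubgroup K S := by
    have h := (ramificationSubgroup_normal K S).conj_mem _
      (greenbergInertia_le_ramificationSubgroup hvS hxI) σ⁻¹
    rwa [inv_inv] at h
  have hval : (z.1 (subgroupConj κ.kerSubgroup σ (inertiaInToH κ.kerSubgroup v x)) :
      PrimaryTorsion (geomPoints W) p) = 0 := by
    rw [hz, show ((subgroupConj κ.kerSubgroup σ (inertiaInToH κ.kerSubgroup v x) : κ.kerSubgroup) :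
      absoluteGaloisGroup K) = σ⁻¹ * ((x : GreenbergSelmer.decomp (K := K) v) : absoluteGaloisGroup K) * σ
      from rfl, hc _ hxN, BigRepModule.zero_apply]
    rfl
  rw [show z.1 (subgroupConj κ.kerSubgroup σ (inertiaInToH κ.kerSubgroup v x)) = 0 from hval, smul_zero]

/-- **(⇐) If the Shapiro class of `c` lies in `H¹(K_Σ/K_∞, E[p^∞])` then `c` vanishes on `N_S`** (`S = S₀ ∪ {v ∣ p}`,
`N_S` fixing `E[p^∞]`). Step 1: for `x` in the chosen inertia group `I_{𝔓₀}` at `v ∉ S` (so `x ∈ N_S ≤ ker κ` acts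
trivially), unramifiedness of every conjugate gives `c(σ⁻¹ x σ)(0) = 0` for all `σ`, and the conjugation identity
`ρ(σ) c(σ⁻¹ x σ)(0) = c(x)(κ σ) + (x·b − b)` (`BigRepModule.rho_apply_conj_zero`: Shapiro turns conjugates into the
values `κ σ ∈ ℤ_p = Γ`) with `κ` onto gives `c(x) = 0`. Step 2: `{n ∈ N_S | c(n) = 0}` is a closed normal subgroup
(`c(g n g⁻¹) = c(g) + g·c(g⁻¹) = 0` as `n` acts trivially on `𝒜_Γ`) containing every `I_𝔓 = τ I_{𝔓₀} τ⁻¹`, `𝔓 ∣ v ∉ S`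
(transitivity on primes, `exists_smul_eq_of_mem_primesAbove_holds`), hence all of `N_S`.
[cite: GreenbergLNM1716, proof of Prop. 4.9 p. 113] [cite: SkinnerUrban2014, §3.1.2 ((3.1.2.a))]
[cite: NeukirchSchmidtWingberg2008, VIII §3] [cite: NeukirchANT1999, Ch. I §9 (9.1), (9.4)] -/
theorem apply_eq_zero_of_shapiro_mem_unramifiedOutside
    (hS₀ : S₀ ⊆ S) (hSp : ∀ v : HeightOneSpectrum (𝓞 K), ((p : ℕ) : 𝓞 K) ∈ v.asIdeal → v ∈ S)
    (hNS : ∀ n ∈ ramificationSubgroup K S, ∀ P : PrimaryTorsion W.geomPoints p, n • P = P)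
    (c : contOneCocycles (AnticyclotomicBigGaloisRep κ (W.primaryTorsionGaloisRep p)).toTopRep)
    (z : contOneCocycles (discreteTopRep κ.kerSubgroup ↥(W.geomPrimaryTorsion p)))
    (hz : ∀ h : κ.kerSubgroup, (z.1 h : PrimaryTorsion (geomPoints W) p) =
      (c.1 (h : absoluteGaloisGroup K) : BigRepModule ℤ_[p] p (PrimaryTorsion (geomPoints W) p)) 0)
    (hmem : (oneCocycleClass _ z : W.subgroupH1 p κ.kerSubgroup) ∈
      unramifiedOutside κ.kerSubgroup ↥(W.geomPrimaryTorsion p) p S₀) :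
    ∀ n ∈ ramificationSubgroup K S,
      (c.1 n : BigRepModule ℤ_[p] p (PrimaryTorsion (geomPoints W) p)) = 0 := by
  have hρ : ∀ (g : absoluteGaloisGroup K) (a : PrimaryTorsion (geomPoints W) p),
      W.primaryTorsionGaloisRep p g a = g • a := fun g a ↦ rfl
  have hcoc : ∀ g h : absoluteGaloisGroup K,
      (c.1 (g * h) : BigRepModule ℤ_[p] p (PrimaryTorsion (geomPoints W) p)) =
        c.1 g + bigRep κ.toContinuousMonoidHom (W.primaryTorsionGaloisRep p) g (c.1 h) := fun g h ↦ c.2 g h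
  rw [mem_unramifiedOutside_iff] at hmem
  -- Step 1: `c` kills the chosen inertia group `I_{𝔓₀}` at every `v ∉ S`
  have step1 : ∀ v : HeightOneSpectrum (𝓞 K), v ∉ S →
      ∀ x ∈ (adicCompletionPrime K v).inertia (absoluteGaloisGroup K),
        (c.1 x : BigRepModule ℤ_[p] p (PrimaryTorsion (geomPoints W) p)) = 0 := by
    intro v hvS x hx
    have hv₀ : v ∉ S₀ := fun h ↦ hvS (hS₀ h)
    have hpv : ((p : ℕ) : 𝓞 K) ∉ v.asIdeal := fun h ↦ hvS (hSp v h)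
    have hxI : x ∈ GreenbergSelmer.inertia v := by
      have e : GreenbergSelmer.inertia v = (adicCompletionPrime K v).inertia (absoluteGaloisGroup K) :=
        (inertia_adicCompletionPrime_eq_map_absInertia K v).symm
      rw [e]; exact hx
    have hxN : x ∈ ramificationSubgroup K S := greenbergInertia_le_ramificationSubgroup hvS hxI
    have hxκ : x ∈ κ.kerSubgroup := ramificationSubgroup_le_kerSubgroup κ hSp hxN
    have hxD : x ∈ GreenbergSelmer.decomp (K := K) v := GreenbergSelmer.inertia_le_decomp v hxI
    -- `c(σ⁻¹ x σ)(0) = 0` for every `σ`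
    have hval : ∀ σ : absoluteGaloisGroup K,
        (c.1 (σ⁻¹ * x * σ) : BigRepModule ℤ_[p] p (PrimaryTorsion (geomPoints W) p)) 0 = 0 := by
      intro σ
      have h := hmem v hv₀ hpv σ
      rw [GreenbergVatsal2000.unramifiedKer, AddMonoidHom.mem_ker, conjH1_oneCocycleClass_eq', resH1Hom_oneCocycleClass_eq',
        oneCocycleClass_eq_zero_iff] at h
      obtain ⟨m, hm⟩ := h
      let y : inertiaIn κ.kerSubgroup v :=
        ⟨⟨x, hxD⟩, (mem_inertiaIn_iff κ.kerSubgroup v ⟨x, hxD⟩).2 ⟨hxκ, hxI⟩⟩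
      have hy := hm y
      have hym : (discreteTopRep (inertiaIn κ.kerSubgroup v) ↥(W.geomPrimaryTorsion p)).ρ y m = m := by
        change x • m = m
        exact hNS x hxN m
      rw [hym, sub_self] at hy
      change σ • z.1 (subgroupConj κ.kerSubgroup σ (inertiaInToH κ.kerSubgroup v y)) = 0 at hy
      rw [smul_eq_zero_iff_eq] at hy
      have hzval := hz (subgroupConj κ.kerSubgroup σ (inertiaInToH κ.kerSubgroup v y))
      rw [hy] at hzval
      exact hzval.symm
    -- evaluate `c x` at every `t = κ σ ∈ ℤ_p` through the conjugation identity
    refine BigRepModule.ext fun t ↦ ?_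
    obtain ⟨σ, hσ⟩ := κ.surjective (Multiplicative.ofAdd t)
    have hκx : κ.toContinuousMonoidHom x = 1 := ZpExtension.mem_kerSubgroup.1 hxκ
    have key : W.primaryTorsionGaloisRep p σ
        ((c.1 (σ⁻¹ * x * σ) : BigRepModule ℤ_[p] p (PrimaryTorsion (geomPoints W) p)) 0) =
        (c.1 x : BigRepModule ℤ_[p] p (PrimaryTorsion (geomPoints W) p)) (κ σ).toAdd +
          (W.primaryTorsionGaloisRep p x
              ((c.1 σ : BigRepModule ℤ_[p] p (PrimaryTorsion (geomPoints W) p)) (κ σ).toAdd) -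
            (c.1 σ : BigRepModule ℤ_[p] p (PrimaryTorsion (geomPoints W) p)) (κ σ).toAdd) :=
      BigRepModule.rho_apply_conj_zero (κ := κ.toContinuousMonoidHom) (ρ := W.primaryTorsionGaloisRep p)
        (c := fun g ↦ (c.1 g : BigRepModule ℤ_[p] p (PrimaryTorsion (geomPoints W) p))) hcoc σ hκx
    rw [hval σ, map_zero, hρ x, hNS x hxN, sub_self, add_zero] at key
    have hκσ : (κ σ).toAdd = t := by
      change (κ.toContinuousMonoidHom σ).toAdd = t
      rw [hσ, toAdd_ofAdd]
    rw [hκσ] at key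
    rw [BigRepModule.zero_apply]
    exact key.symm
  -- Step 2: `H = {n ∈ N_S | c n = 0}` is a closed normal subgroup containing the inertia outside `S`
  have hN1 : ∀ n ∈ ramificationSubgroup K S, ∀ Φ : BigRepModule ℤ_[p] p (PrimaryTorsion (geomPoints W) p),
      AnticyclotomicBigGaloisRep κ (W.primaryTorsionGaloisRep p) n Φ = Φ := fun n hn Φ ↦
    anticyclotomicBigGaloisRep_apply_of_mem_ramificationSubgroup W κ hSp hNS hn Φ
  let H : Subgroup (absoluteGaloisGroup K) :=
    { carrier := {n | n ∈ ramificationSubgroup K S ∧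
        (c.1 n : BigRepModule ℤ_[p] p (PrimaryTorsion (geomPoints W) p)) = 0}
      one_mem' := ⟨one_mem _, contOneCocycles.apply_one c⟩
      mul_mem' := fun {a b} ha hb ↦ ⟨mul_mem ha.1 hb.1, by
        rw [hcoc, ha.2, hb.2, map_zero, add_zero]⟩
      inv_mem' := fun {a} ha ↦ ⟨inv_mem ha.1, by
        have h := hcoc a⁻¹ a
        rw [inv_mul_cancel, contOneCocycles.apply_one, ha.2, map_zero, add_zero] at h
        exact h.symm⟩ }
  have hHN : ∀ n, n ∈ H → n ∈ ramificationSubgroup K S := fun n hn ↦ hn.1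
  haveI hHnormal : H.Normal := ⟨fun n hn g ↦ ⟨(ramificationSubgroup_normal K S).conj_mem n hn.1 g, by
    have h1 : (c.1 (g * g⁻¹) : BigRepModule ℤ_[p] p (PrimaryTorsion (geomPoints W) p)) = 0 := by
      rw [mul_inv_cancel, contOneCocycles.apply_one]
    rw [hcoc] at h1
    rw [mul_assoc, hcoc, hcoc, hn.2, zero_add]
    change (c.1 g : BigRepModule ℤ_[p] p (PrimaryTorsion (geomPoints W) p)) +
      bigRep κ.toContinuousMonoidHom (W.primaryTorsionGaloisRep p) g
        (AnticyclotomicBigGaloisRep κ (W.primaryTorsionGaloisRep p) n (c.1 g⁻¹)) = 0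
    rw [hN1 n hn.1]
    exact h1⟩⟩
  have hHcl : IsClosed (H : Set (absoluteGaloisGroup K)) :=
    IsClosed.inter (ramificationSubgroup_isClosed K S) (isClosed_eq c.1.continuous continuous_const)
  have hHI : ∀ v ∉ S, ∀ 𝔓 ∈ v.primesAbove, 𝔓.inertia (absoluteGaloisGroup K) ≤ H := by
    intro v hvS 𝔓 h𝔓 y hy
    obtain ⟨τ, rfl⟩ := HeightOneSpectrum.exists_smul_eq_of_mem_primesAbove_holds
      (adicCompletionPrime_mem_primesAbove K v) h𝔓
    have hy_eq : y = τ * (τ⁻¹ * y * τ) * τ⁻¹ := by group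
    have hg : τ⁻¹ * y * τ ∈ (adicCompletionPrime K v).inertia (absoluteGaloisGroup K) := by
      rwa [← Ideal.conj_mem_inertia_smul_iff (adicCompletionPrime K v) τ, ← hy_eq]
    have hgH : τ⁻¹ * y * τ ∈ H :=
      ⟨inertia_le_ramificationSubgroup hvS (adicCompletionPrime_mem_primesAbove K v) hg, step1 v hvS _ hg⟩
    rw [hy_eq]
    exact hHnormal.conj_mem _ hgH τ
  have hle : ramificationSubgroup K S ≤ H := by
    refine Subgroup.topologicalClosure_minimal _ ?_ hHcl
    refine Subgroup.normalClosure_le_normal fun σ hσ ↦ ?_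
    rw [mem_inertiaOutside_iff] at hσ
    obtain ⟨v, hv, 𝔓, h𝔓, hσ⟩ := hσ
    exact hHI v hv 𝔓 h𝔓 hσ
  have _ := hHN
  exact fun n hn ↦ (hle hn).2

end Unramified

end Summit.BirchSwinnertonDyer.BirchSwinnertonDyer.Theorems.P49Kernel

end
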